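import Literature.Dynamics.Hyperbolic.CLPSplittingPerturbation
import Literature.Dynamics.Hyperbolic.SequenceShadowing

/-!
# The block hyperbolic sequence of a pseudo-orbit in a Chow–Lin–Palmer hyperbolic set

Topic `Literature/Dynamics/Hyperbolic`.  The linear-algebra core of Pilyugin's reduction (LNM 1706, §1.3.4, pp. 45–47)
of the Chow–Lin–Palmer shadowing lemma to his Theorem 1.3.1: along a pseudo-orbit `y ⊆ T` of a `C¹` map `ψ` carrying a
Chow–Lin–Palmer structure `IsCLPHyperbolicSet ψ T P Q N λ Δ` (`ChowLinPalmerShadowing.lean`), the `ν`-block maps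
`Ψ = ψ^ν` linearise to a `(½, N₀)`-HYPERBOLIC SEQUENCE in the sense of `IsHyperbolicSequence`
(`SequenceShadowing.lean`: Pilyugin's conditions (a), (b) of Theorem 1.3.1, and (b') of Theorem 1.3.2).

* §B — the expansion form of (1.88) (`IsCLPHyperbolicSet.norm_le_of_mem_unstable`).
* §C — `exists_rightInverse_clm`: a bounded right inverse `B` of an operator `A` mapping `range Q₁` bijectively onto
  `range Q₂` and bounded below there — `B v` is the unique preimage of `Q₂ v`, linear by uniqueness, bounded by the
  lower bound; no operator is inverted and no completeness of the subspaces is needed.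
* §D — `IsCLPHyperbolicSet.exists_blockSequence`: Pilyugin's §1.3.3 recipe `A_m = P' D P + Q' D Q` ((1.83)–(1.84)) with
  `D = D(ψ^ν)(xs_m)` and the splitting taken at the ARRIVAL POINTS `xs m ∈ T` of the block orbits (in the application
  `xs m = ψ^ν(y_{(m-1)ν})`, rather than the pseudo-orbit points `ξ m = y_{mν}` as printed), under the hypotheses
  `xs (m+1) = ψ^ν(ξ m)`, `½`-smallness of the cross projections (`CLPSplittingPerturbation.lean`) at the nearby points
  `ψ^ν(xs m)`, `xs (m+1)` of `T`, and `‖D(ψ^ν)(xs m) - D(ψ^ν)(ξ m)‖ ≤ ω`: then `A_m S(xs_m) ⊆ S(xs_{m+1})` with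
  contraction `N²λ^ν ≤ ½`; `A_m : U(xs_m) → U(xs_{m+1})` is a bijection expanding by `2` (the (1.88)-solve composed
  with the unstable transfer map `Q(xs_{m+1}) : U(ψ^ν xs_m) → U(xs_{m+1})`); right inverses `B_m` from §C; and
  `‖D(ψ^ν)(xs_m) - A_m‖ ≤ N₀²λ^ν + N₀²(N₀λ^ν + ω)` (the unstable part is expanded in the splitting at `ξ_m`, whose
  image splitting IS the one at `xs_{m+1}`, so no operator-norm factor `‖D(ψ^ν)‖` appears).

DESIGN NOTE.  The printed sketch takes `A_m = DΨ(ξ_m)`, which maps `S(ξ_m)` into `S(Ψξ_m)`, not into `S(ξ_{m+1})`;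
repairing this at the pseudo-orbit points would need a UNIFORM modulus of continuity of `x ↦ P(x)` on `T`, which
condition (2) ("continuous in `x`") does not give on a non-compact `T`.  At the arrival points only the smallness of the
cross projections `Q(z)P(z')` for nearby `z, z' ∈ T` is needed, and that holds unconditionally
(`IsCLPHyperbolicSet.norm_Q_comp_P_le`): the continuity fields of the structure are never used.
Everything is proved.  Consumed by `ChowLinPalmerShadowingProofs.lean`.

## References

* S. Yu. Pilyugin, *Shadowing in Dynamical Systems*, LNM 1706, Springer (1999), §1.3.3 (1.83)–(1.84),
  §1.3.4 (1.91)–(1.92). [Pilyugin1999]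
-/

noncomputable section

open Set Function Metric
open scoped Topology

namespace Literature.Dynamics.Hyperbolic

variable {E : Type*} [NormedAddCommGroup E] [NormedSpace ℝ E]

namespace IsCLPHyperbolicSet

variable {ψ : E → E} {T : Set E} {P Q : E → E →L[ℝ] E} {N lam Δ : ℝ}

/-! ## §B The expansion form of (1.88) -/

/-- EXPANSION FORM OF (1.88): for `u ∈ U(x)`, `‖u‖ ≤ N λ^n ‖D(ψ^n)(x) u‖` (`n ≥ 1`). [folklore] -/
theorem norm_le_of_mem_unstable (h : IsCLPHyperbolicSet ψ T P Q N lam Δ) {x : E} (hx : x ∈ T) {n : ℕ}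
    (hn : 1 ≤ n) {u : E} (hu : u ∈ range (Q x)) : ‖u‖ ≤ N * lam ^ n * ‖fderiv ℝ (ψ^[n]) x u‖ :=
  h.norm_le_of_fderiv_iterate_eq x hx n hn _ u hu
    (h.Q_apply_of_mem_Q (h.iterate_mem hx n) ((h.bijOn_unstable_iterate hx n).mapsTo hu)).symm

/-! ## §C A bounded right inverse from a bijection between ranges of projectors -/

omit [NormedSpace ℝ E] in
/-- The range of a continuous linear map is closed under addition. [folklore] -/
theorem _root_.Literature.Dynamics.Hyperbolic.add_mem_range_clm {𝕜 : Type*} [NontriviallyNormedField 𝕜]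
    [NormedSpace 𝕜 E] (L : E →L[𝕜] E) {a b : E} (ha : a ∈ range L) (hb : b ∈ range L) :
    a + b ∈ range L := by
  obtain ⟨u, rfl⟩ := ha; obtain ⟨v, rfl⟩ := hb
  exact ⟨u + v, map_add L u v⟩

omit [NormedSpace ℝ E] in
/-- The range of a continuous linear map is closed under scalar multiplication. [folklore] -/
theorem _root_.Literature.Dynamics.Hyperbolic.smul_mem_range_clm {𝕜 : Type*} [NontriviallyNormedField 𝕜]
    [NormedSpace 𝕜 E] (L : E →L[𝕜] E) (c : 𝕜) {a : E} (ha : a ∈ range L) : c • a ∈ range L := by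
  obtain ⟨u, rfl⟩ := ha
  exact ⟨c • u, map_smul L c u⟩

/-- **A BOUNDED RIGHT INVERSE WITHOUT INVERTING OPERATORS.**  If the bounded operator `A` maps `range Q₁`
bijectively onto `range Q₂`, `Q₂` is the identity on its range, and `A` is bounded below on `range Q₁`
(`‖u‖ ≤ c ‖A u‖`), then there is a bounded operator `B` with values in `range Q₁`, right inverse to `A` on
`range Q₂`, with `‖B v‖ ≤ c ‖v‖` there (`B v` = the unique preimage of `Q₂ v`; linear by uniqueness). [folklore] -/
theorem _root_.Literature.Dynamics.Hyperbolic.exists_rightInverse_clm (A Q₁ Q₂ : E →L[ℝ] E) {c : ℝ}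
    (hc : 0 ≤ c) (hbij : BijOn A (range Q₁) (range Q₂)) (hQ₂ : ∀ v ∈ range Q₂, Q₂ v = v)
    (hexp : ∀ u ∈ range Q₁, ‖u‖ ≤ c * ‖A u‖) :
    ∃ B : E →L[ℝ] E, (∀ v, B v ∈ range Q₁) ∧ (∀ v ∈ range Q₂, A (B v) = v) ∧
      ∀ v ∈ range Q₂, ‖B v‖ ≤ c * ‖v‖ := by
  classical
  set g : E → E := fun v => Function.invFunOn A (range Q₁) (Q₂ v) with hg_def
  have hg : ∀ v, g v ∈ range Q₁ ∧ A (g v) = Q₂ v := fun v =>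
    Function.invFunOn_pos (hbij.surjOn (mem_range_self v))
  have huniq : ∀ u u', u ∈ range Q₁ → u' ∈ range Q₁ → A u = A u' → u = u' := fun u u' hu hu' heq =>
    hbij.injOn hu hu' heq
  have hadd : ∀ v w, g (v + w) = g v + g w := fun v w =>
    huniq _ _ (hg _).1 (add_mem_range_clm Q₁ (hg v).1 (hg w).1)
      (by rw [(hg _).2, map_add, map_add, (hg v).2, (hg w).2])
  have hsmul : ∀ (a : ℝ) (v : E), g (a • v) = a • g v := fun a v =>
    huniq _ _ (hg _).1 (smul_mem_range_clm Q₁ a (hg v).1)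
      (by rw [(hg _).2, map_smul, map_smul, (hg v).2])
  let gl : E →ₗ[ℝ] E := { toFun := g, map_add' := hadd, map_smul' := hsmul }
  have hbound : ∀ v, ‖gl v‖ ≤ c * ‖Q₂‖ * ‖v‖ := fun v => by
    change ‖g v‖ ≤ c * ‖Q₂‖ * ‖v‖
    calc ‖g v‖ ≤ c * ‖A (g v)‖ := hexp _ (hg v).1
      _ = c * ‖Q₂ v‖ := by rw [(hg v).2]
      _ ≤ c * (‖Q₂‖ * ‖v‖) := mul_le_mul_of_nonneg_left (ContinuousLinearMap.le_opNorm _ _) hc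
      _ = c * ‖Q₂‖ * ‖v‖ := by ring
  refine ⟨gl.mkContinuous (c * ‖Q₂‖) hbound, fun v => (hg v).1, fun v hv => ?_, fun v hv => ?_⟩
  · change A (g v) = v
    rw [(hg v).2, hQ₂ v hv]
  · change ‖g v‖ ≤ c * ‖v‖
    calc ‖g v‖ ≤ c * ‖A (g v)‖ := hexp _ (hg v).1
      _ = c * ‖v‖ := by rw [(hg v).2, hQ₂ v hv]

/-! ## §D The block hyperbolic sequence along a pseudo-orbit (Pilyugin's `A = P'DP + Q'DQ`) -/

/-- `1 - P(x) = Q(x)` on `T`. [folklore] -/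
theorem one_sub_P_eq (h : IsCLPHyperbolicSet ψ T P Q N lam Δ) {x : E} (hx : x ∈ T) :
    (1 : E →L[ℝ] E) - P x = Q x := by
  rw [ContinuousLinearMap.one_def, sub_eq_iff_eq_add, add_comm]
  exact (h.add_eq x hx).symm

/-- **THE BLOCK HYPERBOLIC SEQUENCE.**  Let `ν ≥ 1` with `N₀²λ^ν ≤ 1/4` (`N ≤ N₀`, `1 ≤ N₀`), and let
`xs m, ξ m ∈ T` (`m ∈ ℤ`) with `xs (m+1) = ψ^ν(ξ m)` (in the application: `ξ m = y_{mν}` are the block points of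
a pseudo-orbit and `xs m = ψ^ν(y_{(m-1)ν})` the ARRIVAL points).  Suppose the stable spaces at the nearby points
`ψ^ν(xs m)`, `xs (m+1)` of `T` are `½`-close in both orders and `‖D(ψ^ν)(xs m) - D(ψ^ν)(ξ m)‖ ≤ ω`.  Then
`A_m = P(xs_{m+1}) D(ψ^ν)(xs_m) P(xs_m) + Q(xs_{m+1}) D(ψ^ν)(xs_m) Q(xs_m)` together with the projectors
`P(xs m)` and suitable right inverses `B_m` is a `(½, N₀)`-hyperbolic sequence in the sense of Pilyugin's
Theorem 1.3.1, satisfies the forward unstable invariance and expansion (b') of Theorem 1.3.2, and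
`‖D(ψ^ν)(xs m) - A_m‖ ≤ N₀²λ^ν + N₀²(N₀λ^ν + ω)`.  (Pilyugin1999 §1.3.3–§1.3.4, with the splitting taken at the
arrival points so that no continuity of `x ↦ P(x)` is needed.) [cite: Pilyugin1999, §1.3.4 (proof), §1.3.3 (1.83)–(1.84)] -/
theorem exists_blockSequence [CompleteSpace E] (h : IsCLPHyperbolicSet ψ T P Q N lam Δ)
    {N₀ : ℝ} (hN₀ : N ≤ N₀) (hN₀1 : 1 ≤ N₀) {ν : ℕ} (hν : 1 ≤ ν) (hνl : N₀ ^ 2 * lam ^ ν ≤ 1 / 4)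
    {xs ξ : ℤ → E} (hxs : ∀ m, xs m ∈ T) (hξ : ∀ m, ξ m ∈ T) (hstep : ∀ m, xs (m + 1) = ψ^[ν] (ξ m))
    (hclose₁ : ∀ m, ‖(Q (ψ^[ν] (xs m))).comp (P (xs (m + 1)))‖ ≤ 1 / 2)
    (hclose₂ : ∀ m, ‖(Q (xs (m + 1))).comp (P (ψ^[ν] (xs m)))‖ < 1)
    {ω : ℝ} (hω : ∀ m, ‖fderiv ℝ (ψ^[ν]) (xs m) - fderiv ℝ (ψ^[ν]) (ξ m)‖ ≤ ω) :
    ∃ A B : ℤ → E →L[ℝ] E,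
      IsHyperbolicSequence A (fun m => P (xs m)) B (1 / 2) N₀ ∧
      (∀ m, ∀ v ∈ unstableSpace (fun m => P (xs m)) m,
        A m v ∈ unstableSpace (fun m => P (xs m)) (m + 1)) ∧
      (∀ m, ∀ v ∈ unstableSpace (fun m => P (xs m)) m, ‖v‖ ≤ 1 / 2 * ‖A m v‖) ∧
      ∀ m e, ‖fderiv ℝ (ψ^[ν]) (xs m) e - A m e‖ ≤
        (N₀ ^ 2 * lam ^ ν + N₀ ^ 2 * (N₀ * lam ^ ν + ω)) * ‖e‖ := by
  -- notation
  set D : ℤ → E →L[ℝ] E := fun m => fderiv ℝ (ψ^[ν]) (xs m) with hD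
  set z : ℤ → E := fun m => ψ^[ν] (xs m) with hz
  have hzT : ∀ m, z m ∈ T := fun m => h.iterate_mem (hxs m) ν
  set A : ℤ → E →L[ℝ] E := fun m =>
    (P (xs (m + 1))).comp ((D m).comp (P (xs m))) + (Q (xs (m + 1))).comp ((D m).comp (Q (xs m)))
    with hA
  have hA_apply : ∀ m e,
      A m e = P (xs (m + 1)) (D m (P (xs m) e)) + Q (xs (m + 1)) (D m (Q (xs m) e)) := fun m e => rfl
  -- constants
  have hN := h.N_pos
  have hN0 : 0 ≤ N := hN.le
  have hN₀0 : 0 ≤ N₀ := zero_le_one.trans hN₀1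
  have hlamν : 0 ≤ lam ^ ν := pow_nonneg h.lam_pos.le _
  have hω0 : 0 ≤ ω := (norm_nonneg _).trans (hω 0)
  -- action on stable / unstable vectors
  have hA_stable : ∀ m, ∀ s ∈ range (P (xs m)), A m s = P (xs (m + 1)) (D m s) := by
    intro m s hs
    rw [hA_apply, h.Q_apply_of_mem_P (hxs m) hs, map_zero, map_zero, add_zero,
      h.P_apply_of_mem (hxs m) hs]
  have hA_unstable : ∀ m, ∀ u ∈ range (Q (xs m)), A m u = Q (xs (m + 1)) (D m u) := by
    intro m u hu
    rw [hA_apply, h.P_apply_of_mem_Q (hxs m) hu, map_zero, map_zero, zero_add,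
      h.Q_apply_of_mem_Q (hxs m) hu]
  -- (a): stable invariance and contraction `N² λ^ν ≤ 1/2`
  have hmaps_s : ∀ m, ∀ s ∈ range (P (xs m)), A m s ∈ range (P (xs (m + 1))) := fun m s hs => by
    rw [hA_stable m s hs]; exact mem_range_self _
  have hcontr : ∀ m, ∀ s ∈ range (P (xs m)), ‖A m s‖ ≤ 1 / 2 * ‖s‖ := by
    intro m s hs
    rw [hA_stable m s hs]
    have h1 : ‖D m s‖ ≤ N * lam ^ ν * ‖s‖ := by
      have := h.norm_fderiv_iterate_P_le (hxs m) ν s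
      rwa [h.P_apply_of_mem (hxs m) hs] at this
    calc ‖P (xs (m + 1)) (D m s)‖ ≤ ‖P (xs (m + 1))‖ * ‖D m s‖ := ContinuousLinearMap.le_opNorm _ _
      _ ≤ N * (N * lam ^ ν * ‖s‖) := mul_le_mul (h.norm_P_le _ (hxs _)) h1 (norm_nonneg _) hN0
      _ ≤ N₀ * (N₀ * lam ^ ν * ‖s‖) := by gcongr
      _ = N₀ ^ 2 * lam ^ ν * ‖s‖ := by ring
      _ ≤ 1 / 4 * ‖s‖ := mul_le_mul_of_nonneg_right hνl (norm_nonneg _)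
      _ ≤ 1 / 2 * ‖s‖ := by nlinarith [norm_nonneg s]
  -- (b'): unstable invariance and expansion
  have hDu : ∀ m, ∀ u ∈ range (Q (xs m)), D m u ∈ range (Q (z m)) := fun m u hu =>
    (h.bijOn_unstable_iterate (hxs m) ν).mapsTo hu
  have hmaps_u : ∀ m, ∀ u ∈ range (Q (xs m)), A m u ∈ range (Q (xs (m + 1))) := fun m u hu => by
    rw [hA_unstable m u hu]; exact mem_range_self _
  have hexp : ∀ m, ∀ u ∈ range (Q (xs m)), ‖u‖ ≤ 1 / 2 * ‖A m u‖ := by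
    intro m u hu
    have h1 : ‖u‖ ≤ N * lam ^ ν * ‖D m u‖ := h.norm_le_of_mem_unstable (hxs m) hν hu
    have h2 : ‖D m u‖ ≤ N / (1 - 1 / 2) * ‖Q (xs (m + 1)) (D m u)‖ :=
      h.norm_le_of_mem_unstable_of_cross (hzT m) (hxs (m + 1)) (hclose₁ m) (by norm_num) (hDu m u hu)
    rw [hA_unstable m u hu]
    have h3 : ‖D m u‖ ≤ 2 * N * ‖Q (xs (m + 1)) (D m u)‖ := by
      have e : N / (1 - 1 / 2) = 2 * N := by ring
      rwa [e] at h2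
    calc ‖u‖ ≤ N * lam ^ ν * ‖D m u‖ := h1
      _ ≤ N * lam ^ ν * (2 * N * ‖Q (xs (m + 1)) (D m u)‖) :=
          mul_le_mul_of_nonneg_left h3 (mul_nonneg hN0 hlamν)
      _ = 2 * (N * (N * lam ^ ν)) * ‖Q (xs (m + 1)) (D m u)‖ := by ring
      _ ≤ 2 * (N₀ * (N₀ * lam ^ ν)) * ‖Q (xs (m + 1)) (D m u)‖ := by gcongr
      _ = 2 * (N₀ ^ 2 * lam ^ ν) * ‖Q (xs (m + 1)) (D m u)‖ := by ring
      _ ≤ 2 * (1 / 4) * ‖Q (xs (m + 1)) (D m u)‖ := by gcongr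
      _ = 1 / 2 * ‖Q (xs (m + 1)) (D m u)‖ := by ring
  -- bijectivity `U_m → U_{m+1}`
  have hbij : ∀ m, BijOn (A m) (range (Q (xs m))) (range (Q (xs (m + 1)))) := by
    intro m
    refine ⟨hmaps_u m, ?_, ?_⟩
    · intro u hu u' hu' heq
      have hsub : u - u' ∈ range (Q (xs m)) := sub_mem_range_clm _ hu hu'
      have := hexp m (u - u') hsub
      rw [map_sub, heq, sub_self, norm_zero, mul_zero] at this
      exact sub_eq_zero.1 (norm_le_zero_iff.1 this)
    · intro u' hu'
      obtain ⟨w, hw, hw'⟩ := h.exists_mem_unstable_Q_eq (hzT m) (hxs (m + 1)) (hclose₂ m) hu'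
      obtain ⟨u, hu, huw⟩ := (h.bijOn_unstable_iterate (hxs m) ν).surjOn hw
      refine ⟨u, hu, ?_⟩
      rw [hA_unstable m u hu]
      change Q (xs (m + 1)) (fderiv ℝ (ψ^[ν]) (xs m) u) = u'
      rw [huw, hw']
  -- right inverses `B_m`
  have hB : ∀ m, ∃ B : E →L[ℝ] E, (∀ v, B v ∈ range (Q (xs m))) ∧
      (∀ v ∈ range (Q (xs (m + 1))), A m (B v) = v) ∧
      ∀ v ∈ range (Q (xs (m + 1))), ‖B v‖ ≤ 1 / 2 * ‖v‖ := fun m =>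
    exists_rightInverse_clm (A m) (Q (xs m)) (Q (xs (m + 1))) (by norm_num) (hbij m)
      (fun v hv => h.Q_apply_of_mem_Q (hxs (m + 1)) hv) (hexp m)
  choose B hB₁ hB₂ hB₃ using hB
  -- membership conversions
  have hSt : ∀ m v, v ∈ stableSpace (fun m => P (xs m)) m ↔ v ∈ range (P (xs m)) := fun m v =>
    mem_stableSpace
  have h1P : ∀ m, (1 : E →L[ℝ] E) - P (xs m) = Q (xs m) := fun m => h.one_sub_P_eq (hxs m)
  have hUn : ∀ m v, v ∈ unstableSpace (fun m => P (xs m)) m ↔ v ∈ range (Q (xs m)) := fun m v => by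
    rw [mem_unstableSpace, h1P m, Set.mem_range]
  refine ⟨A, B, ?_, ?_, ?_, ?_⟩
  · exact
      { lam_pos := by norm_num
        lam_lt_one := by norm_num
        one_le_N := hN₀1
        proj_idem := fun k v => h.P_apply_of_mem (hxs k) (mem_range_self v)
        norm_P_le := fun k => (h.norm_P_le _ (hxs k)).trans hN₀
        norm_Q_le := fun k => by rw [h1P k]; exact (h.norm_Q_le _ (hxs k)).trans hN₀
        mapsTo_stable := fun k v hv => (hSt (k + 1) _).2 (hmaps_s k v ((hSt k v).1 hv))
        contract := fun k v hv => hcontr k v ((hSt k v).1 hv)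
        mapsTo_unstable := fun k v _ => (hUn k _).2 (hB₁ k v)
        inv_contract := fun k v hv => hB₃ k v ((hUn (k + 1) v).1 hv)
        rightInverse := fun k v hv => hB₂ k v ((hUn (k + 1) v).1 hv) }
  · intro m v hv
    exact (hUn (m + 1) _).2 (hmaps_u m v ((hUn m v).1 hv))
  · intro m v hv
    exact hexp m v ((hUn m v).1 hv)
  · -- the approximation `‖D - A‖ ≤ N₀²λ^ν + N₀²(N₀λ^ν + ω)`
    intro m e
    have hPQ : P (xs m) e + Q (xs m) e = e := h.P_add_Q_apply (hxs m) e
    set s : E := P (xs m) e with hs_def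
    set u : E := Q (xs m) e with hu_def
    have hDe : D m e = D m s + D m u := by rw [← map_add, hPQ]
    have hdiff : D m e - A m e = Q (xs (m + 1)) (D m s) + P (xs (m + 1)) (D m u) := by
      rw [hDe, hA_apply]
      have e1 := h.P_add_Q_apply (hxs (m + 1)) (D m s)
      have e2 := h.P_add_Q_apply (hxs (m + 1)) (D m u)
      have f1 : D m s - P (xs (m + 1)) (D m s) = Q (xs (m + 1)) (D m s) := by
        rw [sub_eq_iff_eq_add, add_comm]; exact e1.symm
      have f2 : D m u - Q (xs (m + 1)) (D m u) = P (xs (m + 1)) (D m u) := by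
        rw [sub_eq_iff_eq_add]; exact e2.symm
      rw [← f1, ← f2]; abel
    -- first term: `‖Q' D s‖ ≤ N · Nλ^ν ‖e‖`
    have hs_le : ‖D m s‖ ≤ N * lam ^ ν * ‖e‖ := h.norm_fderiv_iterate_P_le (hxs m) ν e
    have t1 : ‖Q (xs (m + 1)) (D m s)‖ ≤ N * (N * lam ^ ν * ‖e‖) :=
      (ContinuousLinearMap.le_opNorm _ _).trans
        (mul_le_mul (h.norm_Q_le _ (hxs _)) hs_le (norm_nonneg _) hN0)
    -- second term: expand `D u` in the splitting at `ξ m`; the unstable part is killed by `P(xs (m+1))`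
    have hu_le : ‖u‖ ≤ N * ‖e‖ :=
      (ContinuousLinearMap.le_opNorm _ _).trans (mul_le_mul_of_nonneg_right (h.norm_Q_le _ (hxs m))
        (norm_nonneg _))
    set Dξ : E →L[ℝ] E := fderiv ℝ (ψ^[ν]) (ξ m) with hDξ
    have hsplit : D m u = Dξ (P (ξ m) u) + Dξ (Q (ξ m) u) + (D m - Dξ) u := by
      rw [← map_add, h.P_add_Q_apply (hξ m) u, sub_apply]; abel
    have hkill : P (xs (m + 1)) (Dξ (Q (ξ m) u)) = 0 := by
      apply h.P_apply_of_mem_Q (hxs (m + 1))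
      rw [hstep m]
      exact (h.bijOn_unstable_iterate (hξ m) ν).mapsTo (mem_range_self u)
    have t2 : ‖P (xs (m + 1)) (D m u)‖ ≤ N * ((N * lam ^ ν + ω) * ‖u‖) := by
      rw [hsplit, map_add, map_add, hkill, add_zero, ← map_add]
      calc ‖P (xs (m + 1)) (Dξ (P (ξ m) u) + (D m - Dξ) u)‖
          ≤ ‖P (xs (m + 1))‖ * ‖Dξ (P (ξ m) u) + (D m - Dξ) u‖ := ContinuousLinearMap.le_opNorm _ _
        _ ≤ N * (‖Dξ (P (ξ m) u)‖ + ‖(D m - Dξ) u‖) :=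
            mul_le_mul (h.norm_P_le _ (hxs _)) (norm_add_le _ _) (norm_nonneg _) hN0
        _ ≤ N * (N * lam ^ ν * ‖u‖ + ω * ‖u‖) := by
            apply mul_le_mul_of_nonneg_left _ hN0
            exact add_le_add (h.norm_fderiv_iterate_P_le (hξ m) ν u)
              ((ContinuousLinearMap.le_opNorm _ _).trans (mul_le_mul_of_nonneg_right (hω m) (norm_nonneg _)))
        _ = N * ((N * lam ^ ν + ω) * ‖u‖) := by ring
    rw [hdiff]
    calc ‖Q (xs (m + 1)) (D m s) + P (xs (m + 1)) (D m u)‖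
        ≤ N * (N * lam ^ ν * ‖e‖) + N * ((N * lam ^ ν + ω) * ‖u‖) :=
          (norm_add_le _ _).trans (add_le_add t1 t2)
      _ ≤ N * (N * lam ^ ν * ‖e‖) + N * ((N * lam ^ ν + ω) * (N * ‖e‖)) := by
          have : 0 ≤ N * lam ^ ν + ω := add_nonneg (mul_nonneg hN0 hlamν) hω0
          gcongr
      _ ≤ N₀ * (N₀ * lam ^ ν * ‖e‖) + N₀ * ((N₀ * lam ^ ν + ω) * (N₀ * ‖e‖)) := by
          gcongr
      _ = (N₀ ^ 2 * lam ^ ν + N₀ ^ 2 * (N₀ * lam ^ ν + ω)) * ‖e‖ := by ring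

end IsCLPHyperbolicSet

end Literature.Dynamics.Hyperbolic

end
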